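import Summits.AnomalousDissipation.AnomalousDissipation.Theorems.SawtoothPulseCascadeK1LocalisedCascadeFlatCurvatureCascade
import Summits.AnomalousDissipation.AnomalousDissipation.Theorems.SawtoothPulseCascadeK1LocalisedCascadeMultiplierConstants

/-!
# K1loc, line `Spectral` / SeqCone — helper: THE FULL DERIVATIVE-BOUND SEQUENCE OF THE CASCADE CUT-OFFS (S-B, `hD` socket)

Helper file of the prover lane on the crux `K1LocalisedCascade` (stmt-AnomalousDissipation-19491), route
`SawtoothPulseCascade` (glue seat k1loc-p3; complements ad-k1loc-p2's `…FlatStripData`, which supplies `hPU`, `hXU`, `hX1` of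
`…K1Ledger.exists_multiplier_bundle` / `fibre_estimate_of_profile_data`).  The remaining hypothesis `hD : ∀ k y, |X⁽ᵏ⁾ y| ≤ D k`
asks for bounds of ALL derivatives of the cut-off `X^± = sT((±U_j′ − (1−2ε))/ε)`, while only `D 0, …, D (r+2)` enter the
constants.  `exists_bound_seq_cutoff_deriv_U` / `_neg_` produce such a `D` with the `ε`-FREE low orders of
`…FlatCurvatureCascade`: `D 0 = 1`, `D 1 = 2C₁(M+4)(2πN_j/δ_j)`, `D 2 = (4C₂(M+4)² + 2C₁(2M²+33))(2πN_j/δ_j)²`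
(`0 < ε`, `M ≥ 1`, `e^{−M²/2} ≤ 2ε`), the higher orders being mere existence
(`…MultiplierConstants.exists_bound_seq_iteratedDeriv_of_periodic`).  No definitions; no statement about the stub.
[cite: ElgindiLissMattingly2025, §1 and Rmk. 1.4 (the smoothed pulse profiles)] [problem: turb]
-/

-- `Summit.<Summit>.<Problem>`: single-conjunct summit, the duplicate namespace segment is deliberate.
set_option linter.dupNamespace false

noncomputable section

namespace Summit.AnomalousDissipation.AnomalousDissipation.Theorems.SawtoothPulseCascade.K1Cutoff

open Set Filter Topology Real
open scoped ContDiff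
open Literature.Analysis.FluidPDE.SawtoothCascade Literature.Analysis.FluidPDE.SawtoothCascade.CascadeParams
open Summit.AnomalousDissipation.AnomalousDissipation.Theorems.SawtoothPulseCascade.K1Flat

variable (P : CascadeParams)

/-! ## The full bound sequence `D` of the cascade cut-offs -/

/-- **`hD` for the `+` family with `ε`-free low orders**: for `0 < ε`, `M ≥ 1`, `e^{−M²/2} ≤ 2ε` and bounds `C₁, C₂` of
`|sT′|, |sT″|`, there is `D : ℕ → ℝ` with `D 0 = 1`, `D 1 = 2C₁(M+4)(2πN_j/δ_j)`, `D 2 = (4C₂(M+4)² + 2C₁(2M²+33))(2πN_j/δ_j)²`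
and `|(X⁺_j)⁽ᵏ⁾| ≤ D k` for ALL `k`. [cite: ElgindiLissMattingly2025, §1 and Rmk. 1.4 (the smoothed pulse profiles)] -/
theorem exists_bound_seq_cutoff_deriv_U {j : ℕ} (hδj : 0 < P.δ j) {ε M C₁ C₂ : ℝ} (hε : 0 < ε) (hM : 1 ≤ M)
    (hMε : Real.exp (-(M ^ 2 / 2)) ≤ 2 * ε) (hC₁ : ∀ x, |deriv smoothTransition x| ≤ C₁)
    (hC₂ : ∀ x, |deriv (deriv smoothTransition) x| ≤ C₂) :
    ∃ D : ℕ → ℝ, D 0 = 1 ∧ D 1 = 2 * C₁ * (M + 4) * (2 * Real.pi * P.N j / P.δ j) ∧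
      D 2 = (4 * C₂ * (M + 4) ^ 2 + 2 * C₁ * (2 * M ^ 2 + 33)) * (2 * Real.pi * P.N j / P.δ j) ^ 2 ∧
      ∀ k y, |iteratedDeriv k (fun y => smoothTransition ((deriv (P.U j) y - (1 - 2 * ε)) / ε)) y| ≤ D k := by
  set D₀ : ℕ → ℝ := fun k => if k = 0 then 1 else if k = 1 then 2 * C₁ * (M + 4) * (2 * Real.pi * P.N j / P.δ j) else
    (4 * C₂ * (M + 4) ^ 2 + 2 * C₁ * (2 * M ^ 2 + 33)) * (2 * Real.pi * P.N j / P.δ j) ^ 2 with hD₀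
  have hlow : ∀ k ≤ 2, ∀ y, |iteratedDeriv k (fun y => smoothTransition ((deriv (P.U j) y - (1 - 2 * ε)) / ε)) y| ≤ D₀ k := by
    intro k hk y
    interval_cases k
    · rw [iteratedDeriv_zero]; exact abs_cutoff_le_one _ ε y
    · rw [iteratedDeriv_one]; exact abs_deriv_cutoff_deriv_U_le_of_layer P hδj hε hM hMε hC₁ y
    · rw [show iteratedDeriv 2 (fun y => smoothTransition ((deriv (P.U j) y - (1 - 2 * ε)) / ε)) =
          deriv (deriv fun y => smoothTransition ((deriv (P.U j) y - (1 - 2 * ε)) / ε)) by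
        simp only [iteratedDeriv_succ, iteratedDeriv_zero]]
      exact abs_deriv_deriv_cutoff_deriv_U_le_of_layer P hδj hε hM hMε hC₁ hC₂ y
  obtain ⟨D, hDeq, hD⟩ := exists_bound_seq_iteratedDeriv_of_periodic (periodic_cutoff (P.deriv_U_periodic j) ε)
    (contDiff_cutoff (P.contDiff_deriv_U hδj) ε) hlow
  have h0 : D₀ 0 = 1 := by simp [hD₀]
  have h1 : D₀ 1 = 2 * C₁ * (M + 4) * (2 * Real.pi * P.N j / P.δ j) := by simp [hD₀]
  have h2 : D₀ 2 = (4 * C₂ * (M + 4) ^ 2 + 2 * C₁ * (2 * M ^ 2 + 33)) * (2 * Real.pi * P.N j / P.δ j) ^ 2 := by simp [hD₀]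
  exact ⟨D, (hDeq 0 (by norm_num)).trans h0, (hDeq 1 (by norm_num)).trans h1, (hDeq 2 le_rfl).trans h2, hD⟩

/-- **`hD` for the `−` family** (`X⁻_j = sT((−U_j′ − (1−2ε))/ε)`), same values. [cite: ElgindiLissMattingly2025, §1 and Rmk. 1.4 (the smoothed pulse profiles)] -/
theorem exists_bound_seq_cutoff_neg_deriv_U {j : ℕ} (hδj : 0 < P.δ j) {ε M C₁ C₂ : ℝ} (hε : 0 < ε) (hM : 1 ≤ M)
    (hMε : Real.exp (-(M ^ 2 / 2)) ≤ 2 * ε) (hC₁ : ∀ x, |deriv smoothTransition x| ≤ C₁)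
    (hC₂ : ∀ x, |deriv (deriv smoothTransition) x| ≤ C₂) :
    ∃ D : ℕ → ℝ, D 0 = 1 ∧ D 1 = 2 * C₁ * (M + 4) * (2 * Real.pi * P.N j / P.δ j) ∧
      D 2 = (4 * C₂ * (M + 4) ^ 2 + 2 * C₁ * (2 * M ^ 2 + 33)) * (2 * Real.pi * P.N j / P.δ j) ^ 2 ∧
      ∀ k y, |iteratedDeriv k (fun y => smoothTransition ((-deriv (P.U j) y - (1 - 2 * ε)) / ε)) y| ≤ D k := by
  set D₀ : ℕ → ℝ := fun k => if k = 0 then 1 else if k = 1 then 2 * C₁ * (M + 4) * (2 * Real.pi * P.N j / P.δ j) else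
    (4 * C₂ * (M + 4) ^ 2 + 2 * C₁ * (2 * M ^ 2 + 33)) * (2 * Real.pi * P.N j / P.δ j) ^ 2 with hD₀
  have hlow : ∀ k ≤ 2, ∀ y, |iteratedDeriv k (fun y => smoothTransition ((-deriv (P.U j) y - (1 - 2 * ε)) / ε)) y| ≤ D₀ k := by
    intro k hk y
    interval_cases k
    · rw [iteratedDeriv_zero]; exact abs_cutoff_le_one (fun y => -deriv (P.U j) y) ε y
    · rw [iteratedDeriv_one]; exact abs_deriv_cutoff_neg_deriv_U_le_of_layer P hδj hε hM hMε hC₁ y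
    · rw [show iteratedDeriv 2 (fun y => smoothTransition ((-deriv (P.U j) y - (1 - 2 * ε)) / ε)) =
          deriv (deriv fun y => smoothTransition ((-deriv (P.U j) y - (1 - 2 * ε)) / ε)) by
        simp only [iteratedDeriv_succ, iteratedDeriv_zero]]
      exact abs_deriv_deriv_cutoff_neg_deriv_U_le_of_layer P hδj hε hM hMε hC₁ hC₂ y
  have hVp : Function.Periodic (fun y => -deriv (P.U j) y) 1 := fun y => by simp only [P.deriv_U_periodic j y]
  obtain ⟨D, hDeq, hD⟩ := exists_bound_seq_iteratedDeriv_of_periodic (periodic_cutoff hVp ε)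
    (contDiff_cutoff (P.contDiff_deriv_U hδj).neg ε) hlow
  have h0 : D₀ 0 = 1 := by simp [hD₀]
  have h1 : D₀ 1 = 2 * C₁ * (M + 4) * (2 * Real.pi * P.N j / P.δ j) := by simp [hD₀]
  have h2 : D₀ 2 = (4 * C₂ * (M + 4) ^ 2 + 2 * C₁ * (2 * M ^ 2 + 33)) * (2 * Real.pi * P.N j / P.δ j) ^ 2 := by simp [hD₀]
  exact ⟨D, (hDeq 0 (by norm_num)).trans h0, (hDeq 1 (by norm_num)).trans h1, (hDeq 2 le_rfl).trans h2, hD⟩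

end Summit.AnomalousDissipation.AnomalousDissipation.Theorems.SawtoothPulseCascade.K1Cutoff
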